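import Summits.QuantumFields.YangMills.Theorems.FluctuationComparisonRegPrIntLOrganTangentWindowGaugeInvariance
import Literature.MathematicalPhysics.QuantumFieldTheory.Balaban1983to89.T3NestedUnitLaws
import Literature.MathematicalPhysics.QuantumFieldTheory.Balaban1983to89.B12RegularClassInvariance263
import Literature.MathematicalPhysics.QuantumFieldTheory.Balaban1983to89.T4AxialGaugeFixing
import Summits.QuantumFields.YangMills.Theorems.ConvexGribovBodyBrascampLiebVacuumSCDimensionGapSU2
import HarnessLib

/-!
# UNIQ-MAX∘ AS TYPED IS UNSATISFIABLE ON ANY INHABITED FRAME: fibre maximisers of a gauge-invariant density come in RESIDUAL-GAUGE ORBITS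
# (LEAD typing note R-UNIQ, by kernel; the MODE∘ letter must be re-typed «unique modulo the residual gauge group»)

Cell `ym3-torus` (YM ladder rung R3 = continuum `SU(2)` Yang–Mills on the three-torus — a RUNG, NOT d = 4, NOT infinite volume, NOT a mass
gap, NOT Clay).  LEAD-20520 width seat `ym-ust-20520-w3` (gen 24); `--supports stmt-QuantumFields-20520 --as helper`, count-neutral,
definition-free, default heartbeats; no registry, binder or `Lines/` edit (registered skeleton `Lines/semiclassical_s2beta.lean` v11.4, 0∕5,
★★OWNER RULING №36, untouched).

WHAT THIS IS.  LINE g26-1 «mode_section» (ideator g26) closed MODE∘ `ModeSectionCan` v1.1 by kernel MODULO the one-well letter UNIQ-MAX∘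
(LEAD-20520 g23 TQ-2; ✓p786516 `…ModeSectionKnit`, w5 ✓(L9)(L10), ✓p792537 `…ModeSectionE2EV11.modeSectionCan_of_uniqMax (hU : ⟨UNIQ-MAX∘⟩)`),
whose text asks, for every coarse window datum `V`, a fibre maximiser `Ustar` of `r′ := ρ′ (j+1)` on `{descend U = V} ∩ {PlaqSmall θ_{j+1}}`
that is POINTWISE UNIQUE: `∀ U, descend U = V → PlaqSmall θ_{j+1} U → r′ Ustar ≤ r′ U → U = Ustar`.  But in the MODE∘ frame `ρ′ (j+1)`
carries clause ⑧ («membership modulo a constant»), hence is GAUGE INVARIANT under the FULL fine gauge group (✓p794698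
`gaugeInvariant_of_exists_memAtHeight_exp_mul`), while the fibre `{descend U = V}` and the window `{PlaqSmall θ}` are invariant under the
RESIDUAL gauge group — the fine transformations that are `1` at the block centres (Bałaban's averaging is covariant, `t(U^u) = t(U)^{ū}` with
`ū(y) = u(centre of B(y))`, [Balaban1985Averaging] (11)–(13) p.19; tree axiom `Averaging.covariant`).  Since `L` is odd and `> 1`, every block has
non-centre sites, the residual group acts non-trivially on every configuration, and every maximiser comes with its whole residual orbit of
maximisers.  This file proves that, as KERNEL FACTS:

* §1 ★`descend_gaugeAct_of_residual` (lit ✓`T4AxialGaugeFixing.gaugeAct_const_one` BY NAME) — a fine gauge transformation equal to `1` at every block centre `emb y` does not move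
  the descended (block-averaged) configuration (any group `G`, any averaging `ℰ`).
* §2 the residual group is NON-TRIVIAL ON EVERY CONFIGURATION: `zero_ne_emb` (the origin of `T^{(0)}` is never a block centre: centres have
  coordinates `≡ (L−1)∕2 (mod L)` and `L ≥ 3` divides the side `2L^{m+K+1}`), `negOne` bookkeeping (`-1 ∈ SU(2)` = ✓`BrascampLiebVacuumSC.DimensionGapSU2.neg_one_mem`, `≠ 1`), ★`exists_residual_moving`
  — for EVERY `U` there is a residual `u` with `gaugeAct u U ≠ U` (the transformation `−1` at the origin flips the sign of the bond variable
  leaving the origin in direction `0`).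
* §3 ★★`not_pointwise_uniqueFibreMax` — for every gauge-invariant `r′`, every `θ`, `V`, and every candidate `Ustar` in the fibre-window
  (`descend Ustar = V`, `PlaqSmall θ Ustar`), the pointwise-uniqueness clause is FALSE.
* §4 ★★`uniqMax_conclusion_false` — IN THE ORGAN'S FRAME: from clause ⑧ for `ρ′ (j+1)` alone, for EVERY window datum `V` and every `θ ≥ 0` the
  UNIQ-MAX∘ conclusion `∃ Ustar, descend Ustar = V ∧ PlaqSmall (θ∕2) Ustar ∧ (max) ∧ (pointwise unique)` is FALSE.  Consequently ⟨UNIQ-MAX∘⟩ (the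
  `hU` of ✓p792537) is refuted by ANY instantiation of the MODE∘ frame reaching one height `j` with a non-empty coarse window (e.g. `V = 1`) —
  i.e. it is VACUOUS-OR-FALSE, and `modeSectionCan_of_uniqMax` carries no information about the runs.

REPAIR (R-UNIQ, for the ideator successor; census v3.x): quantify uniqueness MODULO THE RESIDUAL GROUP — `… → r′ Ustar ≤ r′ U → ∃ u, (∀ y,
u (emb y) = 1) ∧ U = gaugeAct u Ustar` — and let the MODE SECTION be a continuous GAUGE-FIXED choice (axial gauge inside blocks: one representative
per residual orbit; Bałaban's `U_k(V)` is unique as an ORBIT, [Balaban1985Variational] Thm 1 p.279 «the unique critical orbit»); the Berge-type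
knit ✓p786324 `continuousOn_of_unique_fibreMax` then applies on the gauge-fixed slice, not on the fibre.  WHAT THIS IS NOT: MODE∘ itself is NOT
refuted (a continuous section of maximisers may exist — choose representatives); nothing of Bałaban's is asserted; O1∕LIN∘∕JEN∘, the five
registered ∘-stubs, crux 20520 `FluctuationComparisonRegPrIntL`, `YM3TorusSU2` NOT proved; no summit is proved or refuted by this file.  R3 =
SU(2) YM₃ on T³ — NOT d = 4, NOT infinite volume, NOT a mass gap, NOT Clay; the Yang–Mills mass gap is NOT proved.
-/

noncomputable section

open Function
open Literature.MathematicalPhysics.QuantumFieldTheory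
open Literature.MathematicalPhysics.QuantumFieldTheory.Balaban1983to89
open Literature.MathematicalPhysics.QuantumFieldTheory.Balaban1983to89.T3ContinuumYM3Torus
open Literature.MathematicalPhysics.QuantumFieldTheory.Balaban1983to89.T3LevelShift
open Literature.MathematicalPhysics.QuantumFieldTheory.Balaban1983to89.T3NestedUnitLaws
open Literature.MathematicalPhysics.QuantumFieldTheory.Balaban1983to89.BalabanUVClass
open Literature.MathematicalPhysics.QuantumFieldTheory.Balaban1983to89.T3UnitLawDensityEML (ℰp)
open Summit.QuantumFields.YangMills.Theorems.OrganTangentWindowGaugeInvariance (gaugeInvariant_of_exists_memAtHeight_exp_mul)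

namespace Summit.QuantumFields.YangMills.Theorems.OrganTangentUniqMaxResidualGauge

/-! ## §1 Residual gauge transformations do not move the block-averaged configuration -/

section Residual

variable (F : T3Family) {G : Type*} [GaugeGroup G] (ℰ : LoopAverage G)

/-- ★ **RESIDUAL TRANSFORMATIONS FIX THE DESCENT**: if `u = 1` at every block centre `emb y` of the fine lattice of run `K+1`, then
`descend (U^u) = descend U` for every fine configuration `U` (Bałaban's averaging is covariant with the coarse transformation `ū(y) = u(emb y)`,
tree axiom `Averaging.covariant`; here `ū ≡ 1`). [cite: Balaban1985Averaging, (11)-(13) p.19] -/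
theorem descend_gaugeAct_of_residual (K : ℕ) (u : GaugeTransf (F.P (K + 1)) 0 G)
    (hu : ∀ y : Site (F.P (K + 1)) 1, u (emb y) = 1) (U : GaugeField (F.P (K + 1)) 0 G) :
    descend F ℰ K (GaugeField.gaugeAct u U) = descend F ℰ K U := by
  have h01 : 0 + 1 ≤ (F.P (K + 1)).m + (F.P (K + 1)).K := by
    change 0 + 1 ≤ F.m + (K + 1); omega
  have hcov := (BlockAveraging.blockAvg (P := F.P (K + 1)) (j := 0) ℰ).covariant h01 u U
  have hone : (fun y : Site (F.P (K + 1)) (0 + 1) => u (emb y)) = fun _ => (1 : G) := by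
    funext y; exact hu y
  unfold descend
  rw [hcov, hone, T4AxialGaugeFixing.gaugeAct_const_one]

end Residual

/-! ## §2 The residual group moves every configuration (`L` odd, `L > 1`) -/

section NonTrivial

variable (F : T3Family)

/-- Block centres have coordinates `y·L + (L−1)∕2`; at height `K+1` the fine side `2L^{m+K+1}` is a multiple of `L`, and `1 ≤ (L−1)∕2 < L`
(`L` odd, `L > 1`), so NO centre has a coordinate equal to `0`: the origin is never a block centre. [cite: Balaban1987RG1, (0.1) p.252] -/
theorem zero_ne_emb (K : ℕ) (y : Site (F.P (K + 1)) 1) : (fun _ => (0 : ZMod ((F.P (K + 1)).sitesPerDir 0))) ≠ emb y := by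
  intro h
  have hL1 : 1 < F.L := F.hL.2
  have hLodd : Odd F.L := F.hL.1
  have h0 := congrFun h ⟨0, by change 0 < 3; norm_num⟩
  -- the 0-th coordinate of the centre, as a natural number below the side
  simp only [emb] at h0
  set n : ℕ := (y ⟨0, by change 0 < 3; norm_num⟩).val * (F.P (K + 1)).L + ((F.P (K + 1)).L - 1) / 2 with hn
  have hPL : (F.P (K + 1)).L = F.L := rfl
  have hside : (F.P (K + 1)).sitesPerDir 0 = 2 * F.L ^ (F.m + (K + 1)) := by
    simp [Params.sitesPerDir]
  -- N ∣ n from the cast being zero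
  have hdvd : (F.P (K + 1)).sitesPerDir 0 ∣ n := (ZMod.natCast_eq_zero_iff n _).mp h0.symm
  -- L ∣ N, hence L ∣ n, hence L ∣ (L-1)/2 — impossible since 0 < (L-1)/2 < L
  have hLN : F.L ∣ (F.P (K + 1)).sitesPerDir 0 := by
    rw [hside]
    exact Dvd.dvd.mul_left (dvd_pow_self F.L (by omega)) 2
  have hLn : F.L ∣ n := dvd_trans hLN hdvd
  have hLn' : F.L ∣ (F.L - 1) / 2 := by
    have : F.L ∣ (y ⟨0, by change 0 < 3; norm_num⟩).val * F.L := Dvd.intro_left _ rfl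
    have h2 := (Nat.dvd_add_right this).mp (by rw [hn, hPL] at hLn; exact hLn)
    exact h2
  have hpos : 0 < (F.L - 1) / 2 := by
    obtain ⟨k, hk⟩ := hLodd
    omega
  have hlt : (F.L - 1) / 2 < F.L := by omega
  exact absurd (Nat.le_of_dvd hpos hLn') (not_le.mpr hlt)

/-- `−1 ≠ 1` in `SU(2)` (as group elements). [folklore] -/
theorem negOne_ne_one :
    (⟨-1, BrascampLiebVacuumSC.DimensionGapSU2.neg_one_mem⟩ : Matrix.specialUnitaryGroup (Fin 2) ℂ) ≠ 1 := by
  intro h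
  have h' := congrArg (fun g : Matrix.specialUnitaryGroup (Fin 2) ℂ => (g : Matrix (Fin 2) (Fin 2) ℂ) 0 0) h
  simp at h'
  norm_num at h'

/-- Left multiplication by `−1` moves every element of `SU(2)`. [folklore] -/
theorem negOne_mul_ne (g : Matrix.specialUnitaryGroup (Fin 2) ℂ) :
    (⟨-1, BrascampLiebVacuumSC.DimensionGapSU2.neg_one_mem⟩ : Matrix.specialUnitaryGroup (Fin 2) ℂ) * g ≠ g := by
  intro h
  have : (⟨-1, BrascampLiebVacuumSC.DimensionGapSU2.neg_one_mem⟩ : Matrix.specialUnitaryGroup (Fin 2) ℂ) = 1 := by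
    have h2 := congrArg (fun x => x * g⁻¹) h
    simpa using h2
  exact negOne_ne_one this

/-- The origin's neighbour in direction `0` is not the origin (the fine torus has side `≥ 2`). [folklore] -/
theorem shift_zero_ne (K : ℕ) :
    Balaban1983to89.Site.shift (P := F.P (K + 1)) (j := 0) (fun _ => 0) ⟨0, by change 0 < 3; norm_num⟩ ≠ fun _ => 0 := by
  intro h
  have h0 := congrFun h ⟨0, by change 0 < 3; norm_num⟩
  simp only [Balaban1983to89.Site.shift, update_self, zero_add] at h0
  -- 1 = 0 in ZMod N forces N = 1, but N = 2·L^(m+K+1) ≥ 2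
  have hPL : (F.P (K + 1)).L = F.L := rfl
  have hside : (F.P (K + 1)).sitesPerDir 0 = 2 * F.L ^ (F.m + (K + 1)) := by
    simp [Params.sitesPerDir]
  have hN2 : 2 ≤ (F.P (K + 1)).sitesPerDir 0 := by
    rw [hside]
    have : 1 ≤ F.L ^ (F.m + (K + 1)) := Nat.one_le_pow _ _ (by have := F.hL.2; omega)
    omega
  have hfact : Fact (1 < (F.P (K + 1)).sitesPerDir 0) := ⟨by omega⟩
  exact one_ne_zero h0

/-- ★ **THE RESIDUAL GROUP MOVES EVERY CONFIGURATION**: for every fine configuration `U` of run `K+1` there is a gauge transformation `u`,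
equal to `1` at every block centre, with `U^u ≠ U` — namely `u := −1` at the origin, `1` elsewhere: it flips the sign of the bond variable on
the bond leaving the origin in direction `0`. [cite: Balaban1985Averaging, (8) p.19, (11) p.19] -/
theorem exists_residual_moving (K : ℕ) (U : GaugeField (F.P (K + 1)) 0 (Matrix.specialUnitaryGroup (Fin 2) ℂ)) :
    ∃ u : GaugeTransf (F.P (K + 1)) 0 (Matrix.specialUnitaryGroup (Fin 2) ℂ),
      (∀ y : Site (F.P (K + 1)) 1, u (emb y) = 1) ∧ GaugeField.gaugeAct u U ≠ U := by
  classical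
  let x₀ : Site (F.P (K + 1)) 0 := fun _ => 0
  let h : Matrix.specialUnitaryGroup (Fin 2) ℂ := ⟨-1, BrascampLiebVacuumSC.DimensionGapSU2.neg_one_mem⟩
  refine ⟨update (fun _ => 1) x₀ h, fun y => ?_, ?_⟩
  · have hne : emb y ≠ x₀ := fun e => zero_ne_emb F K y e.symm
    simp [update_of_ne hne]
  · intro hfix
    let b₀ : PBond (F.P (K + 1)) 0 := ⟨x₀, ⟨0, by change 0 < 3; norm_num⟩⟩
    have hb := congrFun hfix b₀
    have htgt : b₀.tgt ≠ x₀ := shift_zero_ne F K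
    simp only [GaugeField.gaugeAct, update_self, update_of_ne htgt, inv_one, mul_one, b₀] at hb
    exact negOne_mul_ne (U b₀) hb

end NonTrivial

/-! ## §3 No pointwise-unique fibre maximiser of a gauge-invariant density -/

section NoUnique

variable (F : T3Family) (ℰ : LoopAverage (Matrix.specialUnitaryGroup (Fin 2) ℂ))

/-- ★★ **FIBRE MAXIMISERS OF A GAUGE-INVARIANT DENSITY ARE NEVER POINTWISE UNIQUE.**  For any gauge-invariant
`r′ : GaugeField (F.P (K+1)) 0 SU(2) → ℝ`, any `θ`, any coarse `V` and any `Ustar` in the fibre-window (`descend Ustar = V`, `PlaqSmall θ Ustar`),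
the clause «every fibre-window configuration with `r′ Ustar ≤ r′ U` equals `Ustar`» is FALSE: the residual transform `Ustar^u` of §2 is another
such configuration (same descent by §1, same plaquette sizes, same `r′`). [cite: Balaban1985Averaging, (11)-(13) p.19] -/
theorem not_pointwise_uniqueFibreMax (K : ℕ) {r' : GaugeField (F.P (K + 1)) 0 (Matrix.specialUnitaryGroup (Fin 2) ℂ) → ℝ}
    (hr' : GaugeField.GaugeInvariant r') (θ : ℝ) (V : GaugeField (F.P K) 0 (Matrix.specialUnitaryGroup (Fin 2) ℂ))
    (Ustar : GaugeField (F.P (K + 1)) 0 (Matrix.specialUnitaryGroup (Fin 2) ℂ))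
    (hdesc : descend F ℰ K Ustar = V) (hwin : PlaqSmall θ Ustar) :
    ¬ (∀ U, descend F ℰ K U = V → PlaqSmall θ U → r' Ustar ≤ r' U → U = Ustar) := by
  intro huniq
  obtain ⟨u, hu, hmove⟩ := exists_residual_moving F K Ustar
  have h1 : descend F ℰ K (GaugeField.gaugeAct u Ustar) = V := by
    rw [descend_gaugeAct_of_residual F ℰ K u hu, hdesc]
  have h2 : PlaqSmall θ (GaugeField.gaugeAct u Ustar) :=
    (B12RegularClassInvariance263.plaqSmall_gaugeAct_iff θ u Ustar).mpr hwin
  have h3 : r' Ustar ≤ r' (GaugeField.gaugeAct u Ustar) := (hr' u Ustar).symm.le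
  exact hmove (huniq _ h1 h2 h3)

end NoUnique

/-! ## §4 In the organ's frame: the UNIQ-MAX∘ conclusion is false at every window datum -/

section Frame

variable (F : T3Family) {j : ℕ} {prm : ClassParams}
variable {ρ'succ : GaugeField (F.P (j + 1)) 0 (Matrix.specialUnitaryGroup (Fin 2) ℂ) → ℝ}

/-- ★★ **UNIQ-MAX∘'s CONCLUSION IS FALSE AT EVERY DATUM, FROM CLAUSE ⑧ ALONE.**  If the height-`(j+1)` density `ρ′_{j+1}` of the reference tower
satisfies clause ⑧ of the MODE∘∕O1 frame (`∃ κ, MemAtHeight F ℰp (j+1) prm (e^κ·ρ′_{j+1})`), then for every `θ ≥ 0` and EVERY coarse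
configuration `V` there is NO `Ustar` with `descend Ustar = V`, `PlaqSmall (θ∕2) Ustar`, maximal on the `θ`-window fibre AND pointwise unique
there — the exact shape of the `∃ Ustar, …` conclusion of ⟨UNIQ-MAX∘⟩ (`hU` of ✓p792537 `modeSectionCan_of_uniqMax`, with `r′ := ρ′ (j+1)` and
`θ := θBal F.L γ b₀ p₀ (j+1)`).  Hence ⟨UNIQ-MAX∘⟩ is refuted by any instantiation of its frame that reaches a height `j` and a window datum `V`
(the window always contains `V = 1`): the letter is vacuous-or-false as typed; repair R-UNIQ in the module docstring.
[cite: Balaban1985Averaging, (11)-(13) p.19; Balaban1985Variational, Thm 1 p.279] -/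
theorem uniqMax_conclusion_false
    (h8' : ∃ κ : ℝ, MemAtHeight F ℰp (j + 1) prm (fun U => Real.exp κ * ρ'succ U)) {θ : ℝ} (hθ : 0 ≤ θ)
    (V : GaugeField (F.P j) 0 (Matrix.specialUnitaryGroup (Fin 2) ℂ)) :
    ¬ ∃ Ustar : GaugeField (F.P (j + 1)) 0 (Matrix.specialUnitaryGroup (Fin 2) ℂ),
        descend F ℰp j Ustar = V ∧ PlaqSmall (θ / 2) Ustar ∧
        (∀ U, descend F ℰp j U = V → PlaqSmall θ U → ρ'succ U ≤ ρ'succ Ustar) ∧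
        (∀ U, descend F ℰp j U = V → PlaqSmall θ U → ρ'succ Ustar ≤ ρ'succ U → U = Ustar) := by
  rintro ⟨Ustar, hdesc, hhalf, -, huniq⟩
  have hr' : GaugeField.GaugeInvariant ρ'succ := gaugeInvariant_of_exists_memAtHeight_exp_mul F h8'
  have hwin : PlaqSmall θ Ustar := fun p => lt_of_lt_of_le (hhalf p) (by linarith)
  exact not_pointwise_uniqueFibreMax F ℰp j hr' θ V Ustar hdesc hwin huniq

/-- The same with the maximality clause dropped from the hypotheses' use made explicit: pointwise uniqueness ALONE (with membership of `Ustar`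
in the half-window fibre) is already contradictory. [cite: Balaban1985Averaging, (11)-(13) p.19] -/
theorem uniq_clause_false
    (h8' : ∃ κ : ℝ, MemAtHeight F ℰp (j + 1) prm (fun U => Real.exp κ * ρ'succ U)) {θ : ℝ}
    (V : GaugeField (F.P j) 0 (Matrix.specialUnitaryGroup (Fin 2) ℂ))
    (Ustar : GaugeField (F.P (j + 1)) 0 (Matrix.specialUnitaryGroup (Fin 2) ℂ))
    (hdesc : descend F ℰp j Ustar = V) (hwin : PlaqSmall θ Ustar) :
    ¬ (∀ U, descend F ℰp j U = V → PlaqSmall θ U → ρ'succ Ustar ≤ ρ'succ U → U = Ustar) :=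
  not_pointwise_uniqueFibreMax F ℰp j (gaugeInvariant_of_exists_memAtHeight_exp_mul F h8') θ V Ustar hdesc hwin

end Frame

end Summit.QuantumFields.YangMills.Theorems.OrganTangentUniqMaxResidualGauge

end
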